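import Summits.BirchSwinnertonDyer.BirchSwinnertonDyer.Theorems.ThetaPartnerAtTwoSignedControlAtTwoShaTwoNativeAssemblyReal
import Summits.BirchSwinnertonDyer.BirchSwinnertonDyer.Theorems.SchneiderFreeAdditiveX3PoitouTateIdeleProjection
import Literature.NumberTheory.GaloisRepresentations.IdeleTorusHasseCovariant
import Summits.BirchSwinnertonDyer.BirchSwinnertonDyer.Theorems.SchneiderFreeAdditiveX3PoitouTateReciprocitySumHolds
import HarnessLib

/-!
# `poitouTate_sha_tateDual K` for EVERY number field — and the K4 stub `poitouTate_sha_tateDual ℚ` — from TWO displayed bricks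
# beyond `SelmerComplement`: the bridge (nat, R4=) and the local–global principle (A); idèle projections, (R3), Tate duality, (B) DISCHARGED

Crux K4 `SignedControlAtTwo` (stmt-BirchSwinnertonDyer-20309; routes `ThetaPartnerAtTwo` / `ResidualThetaTransportAtTwo`), line
`eulerchar` v13 (lead `bsd-wall-tp2-p3` g5), registered stub `stub_poitouTateShaRat : poitouTate_sha_tateDual ℚ`; seat
`bsd-inputs-k4-p1` (`--supports stmt-BirchSwinnertonDyer-20309`, helper; CONDITIONAL).  Sequel of `…ShaTwoNativeAssemblyReal`
(`poitouTate_sha_tateDual_of_localGlobal_real`: the named fact for any `K` from `SelmerComplement` ∀n, a Tate duality record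
`(inv, hT)`, a family `π` of idèle projections with (R3), the bridge `nat` with (R4=), (A), (B)).  Here four of those inputs are
DISCHARGED by tree theorems of cell `bsd-schneider`:

* `inv := IdeleClassBar.classBarInv K` with `hT := IdeleClassBar.tateDualityHypotheses_classBarD_classBarInv K` (door-c4: Tate
  duality for `(Γ_K, C̄)`, Cassels–Fröhlich VII §11.2 (bis));
* `π := IdeleReadout.ideleProjection K` (door-c5: THE idèle projections at every place, archimedean included);
* (R3) := `PoitouTateReduction.exists_readout_eq_of_assembly (ideleProjection K) ρ₀ hM (IdeleReadout.ideleAssembly n ρ₀ hM)`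
  (door-c5's idèle assembly, Milne I Lemma 4.13, fed to door-c6's readout surjectivity);
* (B) := `IdeleReadout.sha_hom_units_dies_in_idele ρ₀` (door-c5 g18, `IdeleTorusHasseCovariant`: a class of
  `H¹(K, Hom_ℤ(N₁, K̄ˣ))` whose transfers to all completions vanish dies in `H¹(K, Hom_ℤ(N₁, J̄))` — Milne I 4.13 in degree 1 for
  the relation lattice, the idèle-torus Hasse principle).

Results:
* **`poitouTate_sha_tateDual_of_bridge_of_localGlobal`** — for ANY number field `K`: `poitouTate_sha_tateDual K` ⟸
  {`SelmerComplement` of `LocalInvariants.canonical K n` ∀n (= `hE(n)`; cell bsd-schneider door-c4 g18 announces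
  `selmerComplement_canonical_holds`), (nat, R4=) for THE idèle projections and `classBarInv K` (archimedean summands included;
  cell bsd-schneider door-c5 g18 CLAIM 10:24Z), (A) (Brauer–Hasse–Noether for `K(M₀)` + Shapiro in degree 2; seat bsd-line-chl-p2)};
* **`SignedEC.PoitouTateShaRat.poitouTate_sha_tateDual_rat_of_bridge_of_localGlobal`** — the same at `K = ℚ`: the TYPE of its
  conclusion is the registered K4 stub `stub_poitouTateShaRat` verbatim, so the lead closes stub 2 by
  `exact poitouTate_sha_tateDual_rat_of_bridge_of_localGlobal hcomp hR4 hA` the moment the two bricks land for `ℚ`.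

HONEST FRAMING. THEOREMS ONLY (no definition, no named fact, no `sorry`); a reduction — `SelmerComplement`, (nat, R4=), (A) are
displayed hypotheses on existing objects; closes no item; no case of Poitou–Tate or BSD is proved here.

References: [MilneADT2006] I Thm. 4.10 (a) and its proof (p. 58), Thm. 2.13 (a), Lemma 4.13, Thm. 1.8; [CasselsFrohlichANT1967]
Ch. VII §9.6, §10, §11.2 (bis); [Harari2020] Thm. 17.13 (b).
-/

noncomputable section

open Function NumberField IsDedekindDomain CategoryTheory CategoryTheory.Abelian
open scoped NumberField ContRepresentation

set_option linter.dupNamespace false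
set_option autoImplicit false

namespace Summit.BirchSwinnertonDyer.BirchSwinnertonDyer.Theorems.PoitouTateShaTwoReadout

open Field
open Literature.NumberTheory.GaloisRepresentations Literature.NumberTheory.GaloisCohomology
open Literature.NumberTheory.GaloisRepresentations.DiscreteGaloisModule (TateDual tateDual localTatePairingZMod
  unramifiedSubgroup sha shaTwo)
open Literature.Algebra.Homology Literature.Algebra.Homology.DiscreteRep Literature.Algebra.Homology.ExtPresentation
open Literature.NumberTheory.GaloisRepresentations.IdeleClassBar (classBarD classBarInv tateDualityHypotheses_classBarD_classBarInv)
open Literature.AnabelianGeometry.AbsoluteAnabelian.Prop121vii (zmodToQmodZ)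
open Literature.NumberTheory.GaloisRepresentations.FreePresentation (presentationComplex presentationComplex_shortExact
  presModule₁ presModule₂ presProj moduleFinite_presModule₁ moduleFinite_presModule₂)
open Literature.NumberTheory.GaloisRepresentations.HomDual (readout dualF)
open Literature.NumberTheory.GaloisRepresentations.DiscreteGaloisModule (units)
open Summit.BirchSwinnertonDyer.BirchSwinnertonDyer.Theorems.SchneiderFreeAdditiveX3.PoitouTateReduction
  (exists_readout_eq_of_assembly)

/-! ## §1 Any number field: idèle projections, (R3) and the Tate duality record discharged -/

section AnyField

variable {K : Type} [Field K] [NumberField K]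

/-- **`poitouTate_sha_tateDual K` for ANY number field from the bridge (nat, R4=) and the local–global principle (A)** — with
`inv := classBarInv K` (door-c4's Tate duality record `tateDualityHypotheses_classBarD_classBarInv`), `π := ideleProjection K`
(door-c5), (R3) discharged by door-c5's idèle assembly through door-c6's `exists_readout_eq_of_assembly`, and (B) discharged by
door-c5's `IdeleReadout.sha_hom_units_dies_in_idele`.  Displayed: `SelmerComplement` of the canonical invariant maps at every
level (= `hE(n)`), the bridge `nat : H¹(K, M₀^{DD}) ≅ Ext¹(ℤ, M₀)` with the (R4) identity in EQUALITY form for THE idèle readout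
(archimedean summands included), and (A) (for `c ∈ Ш²(K, M₀^D)` the class `H²(p^*)(H²(e) c) ∈ H²(K, Hom_ℤ(P, K̄ˣ))` vanishes).
[cite: MilneADT2006, Ch. I, Thm. 4.10 (a) (proof, p. 58), Lemma 4.13, Thm. 1.8][cite: CasselsFrohlichANT1967, Ch. VII §11.2 (bis)]
[cite: Harari2020, Thm. 17.13 (b)] -/
theorem poitouTate_sha_tateDual_of_bridge_of_localGlobal
    (hcomp : ∀ (n : ℕ) [NeZero n], (LocalInvariants.canonical K n).SelmerComplement)
    (hR4 : ∀ (n : ℕ) [NeZero n],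
      ∀ ⦃M : Type⦄ [AddCommGroup M] [TopologicalSpace M] [DiscreteTopology M] [Finite M] [Finite (TateDual K M n)]
      (ρ₀ : DiscreteGaloisModule K M) (hM : ∀ m : M, n • m = 0),
      ∃ nat : galoisCohomology ((ρ₀.tateDual n).tateDual n) 1 →+
          Abelian.Ext (triv (Γ := absoluteGaloisGroup K) ℤ) (presentationComplex ρ₀).X₃ 1,
        Function.Bijective nat ∧
        ∀ f : (presentationComplex ρ₀).X₁ ⟶ (ideleClassLimitShortComplex K).X₂, ∃ Tf : Finset (Place K),
          ∀ (y : galoisCohomology ((ρ₀.tateDual n).tateDual n) 1) (T' : Finset (Place K)), Tf ⊆ T' →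
            (∀ v : HeightOneSpectrum (𝓞 K), (Sum.inr v : Place K) ∉ T' →
              galoisCohomology.localization ((ρ₀.tateDual n).tateDual n) (Sum.inr v) 1 y ∈
                unramifiedSubgroup (GaloisRep.toLocal v ((ρ₀.tateDual n).tateDual n)) 1) →
            zmodToQmodZ n (∑ v ∈ T', localTatePairingZMod (ρ₀.tateDual n) n v (LocalInvariants.canonical K n v)
              (readout ρ₀ n hM (IdeleReadout.ideleProjection K v) f)
              (galoisCohomology.localization ((ρ₀.tateDual n).tateDual n) v 1 y)) =
            classBarInv K ((nat y).comp (boundary (presentationComplex_shortExact ρ₀) (classBarD K)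
              (f ≫ (ideleClassLimitShortComplex K).g)) (rfl : 1 + 1 = 2)))
    (hA : ∀ (n : ℕ) [NeZero n],
      ∀ ⦃M : Type⦄ [AddCommGroup M] [TopologicalSpace M] [DiscreteTopology M] [Finite M]
      (ρ₀ : DiscreteGaloisModule K M) (hM : ∀ m : M, n • m = 0),
        haveI := moduleFinite_presModule₂ ρ₀
        ∀ c ∈ shaTwo (ρ₀.tateDual n),
          cohomologyMap (dualF (presModule₂ ρ₀) ρ₀ (units K) (presProj ρ₀)) 2
            (cohomologyMap (HomDual.tateDualUnitsIso K ρ₀ n hM).hom 2 c) = 0) :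
    poitouTate_sha_tateDual K :=
  poitouTate_sha_tateDual_of_localGlobal_real hcomp (classBarInv K) (tateDualityHypotheses_classBarD_classBarInv K)
    (IdeleReadout.ideleProjection K)
    (fun n _ _ _ _ _ _ _ ρ₀ hM => exists_readout_eq_of_assembly (IdeleReadout.ideleProjection K) ρ₀ hM
      (IdeleReadout.ideleAssembly (K := K) n ρ₀ hM))
    hR4 hA (fun _ _ _ _ _ _ _ ρ₀ => IdeleReadout.sha_hom_units_dies_in_idele ρ₀)

end AnyField

end Summit.BirchSwinnertonDyer.BirchSwinnertonDyer.Theorems.PoitouTateShaTwoReadout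

/-! ## §2 The K4 stub over `ℚ` -/

namespace Summit.BirchSwinnertonDyer.BirchSwinnertonDyer.Theorems.SignedEC.PoitouTateShaRat

open Field
open Literature.NumberTheory.GaloisRepresentations Literature.NumberTheory.GaloisCohomology
open Literature.NumberTheory.GaloisRepresentations.DiscreteGaloisModule (TateDual tateDual localTatePairingZMod
  unramifiedSubgroup sha shaTwo units)
open Literature.Algebra.Homology Literature.Algebra.Homology.DiscreteRep Literature.Algebra.Homology.ExtPresentation
open Literature.NumberTheory.GaloisRepresentations.IdeleClassBar (classBarD classBarInv)
open Literature.AnabelianGeometry.AbsoluteAnabelian.Prop121vii (zmodToQmodZ)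
open Literature.NumberTheory.GaloisRepresentations.FreePresentation (presentationComplex presentationComplex_shortExact
  presModule₁ presModule₂ presProj moduleFinite_presModule₁ moduleFinite_presModule₂)
open Literature.NumberTheory.GaloisRepresentations.HomDual (readout dualF)
open Summit.BirchSwinnertonDyer.BirchSwinnertonDyer.Theorems.PoitouTateShaTwoReadout
  (poitouTate_sha_tateDual_of_bridge_of_localGlobal)

/-- **K4 line `eulerchar` v13, stub 2 `stub_poitouTateShaRat : poitouTate_sha_tateDual ℚ` from the two bricks at `K = ℚ`**:
`SelmerComplement` of the canonical invariant maps of `ℚ` at every level (= `hE(n)` over `ℚ`), the bridge (nat, R4=) for THE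
idèle readout of `ℚ` (the one real place `∞` included in the sums), and the local–global principle (A) over `ℚ` ((B) is door-c5's
theorem `IdeleReadout.sha_hom_units_dies_in_idele`).
The conclusion is the registered stub's type verbatim.  HONEST FRAMING: conditional; closes nothing by itself.
[cite: MilneADT2006, Ch. I, Thm. 4.10 (a) (proof, p. 58), Lemma 4.13][cite: Harari2020, Thm. 17.13 (b)] -/
theorem poitouTate_sha_tateDual_rat_of_bridge_of_localGlobal
    (hcomp : ∀ (n : ℕ) [NeZero n], (LocalInvariants.canonical ℚ n).SelmerComplement)
    (hR4 : ∀ (n : ℕ) [NeZero n],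
      ∀ ⦃M : Type⦄ [AddCommGroup M] [TopologicalSpace M] [DiscreteTopology M] [Finite M] [Finite (TateDual ℚ M n)]
      (ρ₀ : DiscreteGaloisModule ℚ M) (hM : ∀ m : M, n • m = 0),
      ∃ nat : galoisCohomology ((ρ₀.tateDual n).tateDual n) 1 →+
          Abelian.Ext (triv (Γ := absoluteGaloisGroup ℚ) ℤ) (presentationComplex ρ₀).X₃ 1,
        Function.Bijective nat ∧
        ∀ f : (presentationComplex ρ₀).X₁ ⟶ (ideleClassLimitShortComplex ℚ).X₂, ∃ Tf : Finset (Place ℚ),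
          ∀ (y : galoisCohomology ((ρ₀.tateDual n).tateDual n) 1) (T' : Finset (Place ℚ)), Tf ⊆ T' →
            (∀ v : HeightOneSpectrum (𝓞 ℚ), (Sum.inr v : Place ℚ) ∉ T' →
              galoisCohomology.localization ((ρ₀.tateDual n).tateDual n) (Sum.inr v) 1 y ∈
                unramifiedSubgroup (GaloisRep.toLocal v ((ρ₀.tateDual n).tateDual n)) 1) →
            zmodToQmodZ n (∑ v ∈ T', localTatePairingZMod (ρ₀.tateDual n) n v (LocalInvariants.canonical ℚ n v)
              (readout ρ₀ n hM (IdeleReadout.ideleProjection ℚ v) f)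
              (galoisCohomology.localization ((ρ₀.tateDual n).tateDual n) v 1 y)) =
            classBarInv ℚ ((nat y).comp (boundary (presentationComplex_shortExact ρ₀) (classBarD ℚ)
              (f ≫ (ideleClassLimitShortComplex ℚ).g)) (rfl : 1 + 1 = 2)))
    (hA : ∀ (n : ℕ) [NeZero n],
      ∀ ⦃M : Type⦄ [AddCommGroup M] [TopologicalSpace M] [DiscreteTopology M] [Finite M]
      (ρ₀ : DiscreteGaloisModule ℚ M) (hM : ∀ m : M, n • m = 0),
        haveI := moduleFinite_presModule₂ ρ₀
        ∀ c ∈ shaTwo (ρ₀.tateDual n),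
          cohomologyMap (dualF (presModule₂ ρ₀) ρ₀ (units ℚ) (presProj ρ₀)) 2
            (cohomologyMap (HomDual.tateDualUnitsIso ℚ ρ₀ n hM).hom 2 c) = 0) :
    poitouTate_sha_tateDual ℚ :=
  poitouTate_sha_tateDual_of_bridge_of_localGlobal hcomp hR4 hA

end Summit.BirchSwinnertonDyer.BirchSwinnertonDyer.Theorems.SignedEC.PoitouTateShaRat


/-! ## §3 (appended) `SelmerComplement` DISCHARGED: `poitouTate_sha_tateDual K` ⟸ {(nat, R4=), (A)} — door-c4 g18's
`selmerComplement_canonical_holds` (`…SchneiderFreeAdditiveX3PoitouTateReciprocitySumHolds`, Milne I 4.10 (b) for THE canonical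
invariant maps at every level, from the idèle package) plugged into §1/§2 -/

namespace Summit.BirchSwinnertonDyer.BirchSwinnertonDyer.Theorems.PoitouTateShaTwoReadout

open Field
open Literature.NumberTheory.GaloisRepresentations Literature.NumberTheory.GaloisCohomology
open Literature.NumberTheory.GaloisRepresentations.DiscreteGaloisModule (TateDual tateDual localTatePairingZMod
  unramifiedSubgroup sha shaTwo units)
open Literature.Algebra.Homology Literature.Algebra.Homology.DiscreteRep Literature.Algebra.Homology.ExtPresentation
open Literature.NumberTheory.GaloisRepresentations.IdeleClassBar (classBarD classBarInv)
open Literature.AnabelianGeometry.AbsoluteAnabelian.Prop121vii (zmodToQmodZ)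
open Literature.NumberTheory.GaloisRepresentations.FreePresentation (presentationComplex presentationComplex_shortExact
  presModule₂ presProj moduleFinite_presModule₂)
open Literature.NumberTheory.GaloisRepresentations.HomDual (readout dualF)
open Summit.BirchSwinnertonDyer.BirchSwinnertonDyer.Theorems.SchneiderFreeAdditiveX3.PoitouTateReduction
  (selmerComplement_canonical_holds)

section Discharged

variable {K : Type} [Field K] [NumberField K]

/-- **`poitouTate_sha_tateDual K` (Milne I Thm. 4.10 (a), all finite modules) for ANY number field from TWO displayed bricks**:
the bridge (nat, R4=) for THE idèle readout with `inv := classBarInv K` (archimedean summands included), and the local–global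
principle (A) (Brauer–Hasse–Noether for `K(M₀)` + Shapiro in degree `2`, on `Ш²`-classes).  `SelmerComplement` of the canonical
invariant maps at every level is now door-c4 g18's THEOREM `selmerComplement_canonical_holds K n`; (inv, hT), `π`, (R3), (B) as in
§1. [cite: MilneADT2006, Ch. I, Thm. 4.10 (a)(b) (proof, p. 58), Lemma 4.13][cite: Harari2020, Thm. 17.13 (b)] -/
theorem poitouTate_sha_tateDual_of_bridge_of_localGlobal'
    (hR4 : ∀ (n : ℕ) [NeZero n],
      ∀ ⦃M : Type⦄ [AddCommGroup M] [TopologicalSpace M] [DiscreteTopology M] [Finite M] [Finite (TateDual K M n)]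
      (ρ₀ : DiscreteGaloisModule K M) (hM : ∀ m : M, n • m = 0),
      ∃ nat : galoisCohomology ((ρ₀.tateDual n).tateDual n) 1 →+
          Abelian.Ext (triv (Γ := absoluteGaloisGroup K) ℤ) (presentationComplex ρ₀).X₃ 1,
        Function.Bijective nat ∧
        ∀ f : (presentationComplex ρ₀).X₁ ⟶ (ideleClassLimitShortComplex K).X₂, ∃ Tf : Finset (Place K),
          ∀ (y : galoisCohomology ((ρ₀.tateDual n).tateDual n) 1) (T' : Finset (Place K)), Tf ⊆ T' →
            (∀ v : HeightOneSpectrum (𝓞 K), (Sum.inr v : Place K) ∉ T' →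
              galoisCohomology.localization ((ρ₀.tateDual n).tateDual n) (Sum.inr v) 1 y ∈
                unramifiedSubgroup (GaloisRep.toLocal v ((ρ₀.tateDual n).tateDual n)) 1) →
            zmodToQmodZ n (∑ v ∈ T', localTatePairingZMod (ρ₀.tateDual n) n v (LocalInvariants.canonical K n v)
              (readout ρ₀ n hM (IdeleReadout.ideleProjection K v) f)
              (galoisCohomology.localization ((ρ₀.tateDual n).tateDual n) v 1 y)) =
            classBarInv K ((nat y).comp (boundary (presentationComplex_shortExact ρ₀) (classBarD K)
              (f ≫ (ideleClassLimitShortComplex K).g)) (rfl : 1 + 1 = 2)))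
    (hA : ∀ (n : ℕ) [NeZero n],
      ∀ ⦃M : Type⦄ [AddCommGroup M] [TopologicalSpace M] [DiscreteTopology M] [Finite M]
      (ρ₀ : DiscreteGaloisModule K M) (hM : ∀ m : M, n • m = 0),
        haveI := moduleFinite_presModule₂ ρ₀
        ∀ c ∈ shaTwo (ρ₀.tateDual n),
          cohomologyMap (dualF (presModule₂ ρ₀) ρ₀ (units K) (presProj ρ₀)) 2
            (cohomologyMap (HomDual.tateDualUnitsIso K ρ₀ n hM).hom 2 c) = 0) :
    poitouTate_sha_tateDual K :=
  poitouTate_sha_tateDual_of_bridge_of_localGlobal (fun n _ => selmerComplement_canonical_holds K n) hR4 hA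

end Discharged

end Summit.BirchSwinnertonDyer.BirchSwinnertonDyer.Theorems.PoitouTateShaTwoReadout

namespace Summit.BirchSwinnertonDyer.BirchSwinnertonDyer.Theorems.SignedEC.PoitouTateShaRat

open Field
open Literature.NumberTheory.GaloisRepresentations Literature.NumberTheory.GaloisCohomology
open Literature.NumberTheory.GaloisRepresentations.DiscreteGaloisModule (TateDual tateDual localTatePairingZMod
  unramifiedSubgroup sha shaTwo units)
open Literature.Algebra.Homology Literature.Algebra.Homology.DiscreteRep Literature.Algebra.Homology.ExtPresentation
open Literature.NumberTheory.GaloisRepresentations.IdeleClassBar (classBarD classBarInv)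
open Literature.AnabelianGeometry.AbsoluteAnabelian.Prop121vii (zmodToQmodZ)
open Literature.NumberTheory.GaloisRepresentations.FreePresentation (presentationComplex presentationComplex_shortExact
  presModule₂ presProj moduleFinite_presModule₂)
open Literature.NumberTheory.GaloisRepresentations.HomDual (readout dualF)
open Summit.BirchSwinnertonDyer.BirchSwinnertonDyer.Theorems.PoitouTateShaTwoReadout
  (poitouTate_sha_tateDual_of_bridge_of_localGlobal')

/-- **K4 stub 2 `stub_poitouTateShaRat : poitouTate_sha_tateDual ℚ` from the TWO bricks at `K = ℚ` alone** — the bridge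
(nat, R4=) for THE idèle readout of `ℚ` (the real place `∞` included in the sums) and the local–global principle (A) over `ℚ`;
`SelmerComplement` over `ℚ` is door-c4 g18's `selmerComplement_canonical_holds ℚ n`.  The conclusion is the registered stub's type
verbatim: the lead closes stub 2 by `exact poitouTate_sha_tateDual_rat_of_bridge_of_localGlobal' hR4 hA`.
[cite: MilneADT2006, Ch. I, Thm. 4.10 (a)(b) (proof, p. 58), Lemma 4.13][cite: Harari2020, Thm. 17.13 (b)] -/
theorem poitouTate_sha_tateDual_rat_of_bridge_of_localGlobal'
    (hR4 : ∀ (n : ℕ) [NeZero n],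
      ∀ ⦃M : Type⦄ [AddCommGroup M] [TopologicalSpace M] [DiscreteTopology M] [Finite M] [Finite (TateDual ℚ M n)]
      (ρ₀ : DiscreteGaloisModule ℚ M) (hM : ∀ m : M, n • m = 0),
      ∃ nat : galoisCohomology ((ρ₀.tateDual n).tateDual n) 1 →+
          Abelian.Ext (triv (Γ := absoluteGaloisGroup ℚ) ℤ) (presentationComplex ρ₀).X₃ 1,
        Function.Bijective nat ∧
        ∀ f : (presentationComplex ρ₀).X₁ ⟶ (ideleClassLimitShortComplex ℚ).X₂, ∃ Tf : Finset (Place ℚ),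
          ∀ (y : galoisCohomology ((ρ₀.tateDual n).tateDual n) 1) (T' : Finset (Place ℚ)), Tf ⊆ T' →
            (∀ v : HeightOneSpectrum (𝓞 ℚ), (Sum.inr v : Place ℚ) ∉ T' →
              galoisCohomology.localization ((ρ₀.tateDual n).tateDual n) (Sum.inr v) 1 y ∈
                unramifiedSubgroup (GaloisRep.toLocal v ((ρ₀.tateDual n).tateDual n)) 1) →
            zmodToQmodZ n (∑ v ∈ T', localTatePairingZMod (ρ₀.tateDual n) n v (LocalInvariants.canonical ℚ n v)
              (readout ρ₀ n hM (IdeleReadout.ideleProjection ℚ v) f)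
              (galoisCohomology.localization ((ρ₀.tateDual n).tateDual n) v 1 y)) =
            classBarInv ℚ ((nat y).comp (boundary (presentationComplex_shortExact ρ₀) (classBarD ℚ)
              (f ≫ (ideleClassLimitShortComplex ℚ).g)) (rfl : 1 + 1 = 2)))
    (hA : ∀ (n : ℕ) [NeZero n],
      ∀ ⦃M : Type⦄ [AddCommGroup M] [TopologicalSpace M] [DiscreteTopology M] [Finite M]
      (ρ₀ : DiscreteGaloisModule ℚ M) (hM : ∀ m : M, n • m = 0),
        haveI := moduleFinite_presModule₂ ρ₀
        ∀ c ∈ shaTwo (ρ₀.tateDual n),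
          cohomologyMap (dualF (presModule₂ ρ₀) ρ₀ (units ℚ) (presProj ρ₀)) 2
            (cohomologyMap (HomDual.tateDualUnitsIso ℚ ρ₀ n hM).hom 2 c) = 0) :
    poitouTate_sha_tateDual ℚ :=
  poitouTate_sha_tateDual_of_bridge_of_localGlobal' hR4 hA

end Summit.BirchSwinnertonDyer.BirchSwinnertonDyer.Theorems.SignedEC.PoitouTateShaRat

end
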